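import Summits.BirchSwinnertonDyer.BirchSwinnertonDyer.Theorems.KimAtThreeFineKatoOuterRescale
import Summits.BirchSwinnertonDyer.BirchSwinnertonDyer.Theorems.KimAtThreeFineKatoDefinedLambdaKatoV2
import Summits.BirchSwinnertonDyer.BirchSwinnertonDyer.Theorems.KimAtThreeFineKatoDefinedLambdaRescale
import Summits.BirchSwinnertonDyer.BirchSwinnertonDyer.Theorems.KimAtThreeDeepLowerZetaBodyRatScaling
import HarnessLib

/-!
# acc5's hKatoDef (DEFINED value datum `katoLambda`) WITHOUT the duality assertion: hKatoDefPos ⟹ hKatoDef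
# (cell `bsd-addord`, seat w2-acc4 gen 6; `--supports stmt-BirchSwinnertonDyer-19560`, helper)

HONEST FRAMING.  ONE tool theorem; no definition, no named fact, no instance, no `sorry`.  hKatoDefPos is DISPLAYED; (P123)
`cupLogInjective_and_hasDualExp_of_isDeRham`, (DR) `isDeRham_restrictedRationalTateRep`, (S5a), (S5b)
`exists_smul_range_expStarCoord_iff_trace_log`, (S5b-tower) are cite-only facts taken as hypotheses (D-0014).  Nothing is
closed or booked; BSD / 19560 are NOT proved here; the LEAD (kim3) assembles.

WHAT.  w2-acc5 gen 6's hKatoDef (`KimAtThreeFineKatoDefinedLambdaKatoV2`, p528093) is kim3's hKatoV2₀ with the abstract value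
functional REPLACED by the defined `katoLambda` (no `∃ Λ`, no (DEF₀)); it still couples, for ONE generator `d` of the Néron
line at `ℚ_{v₃}`, the Prop-1.2.3 binders `hinj hex`, the duality clause `hdual(d)` ([BK90]/Tate) and R-κ.  **hKatoDefPos** :=
hKatoDef with `hinj`/`hex`/`hdual` DELETED and R-κ REPLACED by the position clause
`POS(d, κK) := ∃ u : ℚ, u = κK ∧ ∀ hinj hex (e ≠ 0), hdual(e • d) → v₃(u) = v(ι₃ e)` (duality only as an antecedent).
`katoDef_of_katoDefPos_of_facts : (P123) → (DR) → (S5b) → hKatoDefPos → hKatoDef` = w2-acc4's abstract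
`KimAtThreeFineKatoOuterRescale.exists_dual_unit_of_position` with Inner := «∃ ι charts, (∀ k r, (RES₀)(d, dw k r)) ∧
ZetaBody-family(ι, κ, katoLambda charts)»; its covariance under `(d, κ) ↦ (c • d, q κ)` (`ι₃ c = q⁻¹`) rescales every `dw k r`
by `algebraMap c` ((RES₀) by w2-c2's `expStarOmega_smul`) and uses w2-acc4's `katoLambda_smul_line`
(`katoLambda (c • dw) = q • katoLambda dw`) with w2-c2's `zetaBody_rat_smul`.  Then
the sequel `KimAtThreeFineKatoDefinedLambdaPositionCrux` composes with acc5's `katoKuriharaPortThreeShared_of_facts_of_katoDef`: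
**crux ⟸ {S5a, S5b, S5b-tower, P123, DR} [cite] ∧ hKatoDefPos** — «Kato 2004 valued by the DEFINED `exp* ∘ loc_p` of SOME
generator + its 3-adic position w.r.t. the duality line», NO [BK90] assertion, NO abstract functional.

References: [Kato2004Asterisque] (8.1.3), 8.12, §9.4/9.7, 6.6 (1), 13.3; [Kato1993LNM1553] II §1.2.4, 1.3.5, 1.4.1;
[BlochKato1990] §3 Prop. 3.8, Ex. 3.11; [CasselsFrohlichANT1967] Ch. II §10, Ch. VII §1.1.
-/

noncomputable section
-- the cell's Theorems namespace `Summit.BirchSwinnertonDyer.BirchSwinnertonDyer.…` repeats the summit name by design (D-0017)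
set_option linter.dupNamespace false

open scoped Classical NumberField TensorProduct ContRepresentation Pointwise
open Field ValuativeRel Function IsDedekindDomain NumberField WeierstrassCurve Literature.NumberTheory.EllipticCurves
open Literature.NumberTheory.GaloisRepresentations Literature.NumberTheory.GaloisRepresentations.DiscreteGaloisModule
open Literature.NumberTheory.GaloisCohomology Literature.NumberTheory.GaloisRepresentations.PeriodRingData
open Literature.NumberTheory.PAdicHodge Literature.NumberTheory.EllipticCurves.ModularForms
open Literature.NumberTheory.EllipticCurves.Rank1Residual Literature.NumberTheory.EllipticCurves.Kato2004
open Literature.NumberTheory.EllipticCurves.Kato2004.EulerSystemValues Literature.NumberTheory.AdelicBaseChange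
open Literature.NumberTheory.Automorphic Summit.BirchSwinnertonDyer.Rank1Residual.GaloisImage
open Summit.BirchSwinnertonDyer.Rank1Residual.Additive.LocalLog Summit.BirchSwinnertonDyer.BirchSwinnertonDyer.Theorems
open KimAtThreeFineKatoPerFactorDefined KimAtThreeDeepLowerExpStarOmega KimAtThreeDeepLowerExpStarOmegaPlace
open KimAtThreeFineKatoPerFactorPlaces KimAtThreeDeepUpperExpStarFacts KimAtThreeDeepUpperExpStarFactsCanonical
open KimAtThreeDeepLowerZetaBodyRatScaling KimAtThreeFineKatoOuterRescale KimAtThreeFineKatoDefinedLambda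
open KimAtThreeFineKatoDefinedLambdaRescale

namespace Summit.BirchSwinnertonDyer.BirchSwinnertonDyer.Theorems.KimAtThreeFineKatoDefinedLambdaPosition

set_option backward.isDefEq.respectTransparency false in
set_option maxHeartbeats 1600000 in
/-- **hKatoDef (acc5's displayed Kato hypothesis with the DEFINED `katoLambda`, VERBATIM) from (P123), (DR), (S5b) and
hKatoDefPos** (= hKatoDef with `hinj`/`hex`/`hdual` deleted and R-κ replaced by POS).  Proof: `exists_dual_unit_of_position`
with Inner := «∃ ι charts, (∀ k r, (RES₀)) ∧ ZetaBody-family(katoLambda)», covariance by rescaling every `dw k r`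
(`expStarOmega_smul`, `katoLambda_smul_line`, `zetaBody_rat_smul`).  hKatoDefPos displayed, three facts cite-only;
closes nothing (`maxHeartbeats 1600000`: two ≈ 75-line displayed packages with `letI` blocks in ONE signature).
[cite: Kato2004Asterisque, (8.1.3) (p. 180), Prop. 8.12 (p. 186), §9.4 and Thm. 9.7 (pp. 188–189), Thm. 6.6 (1) (p. 163), Ex. 13.3 (pp. 224–225)]
[cite: Kato1993LNM1553, Ch. II §1.2.4 and Thm. 1.4.1] [cite: BlochKato1990, §3 (Prop. 3.8, Ex. 3.11)] [cite: CasselsFrohlichANT1967, Ch. II §10 Theorem (10.2) and Ch. VII §1.1] -/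
theorem katoDef_of_katoDefPos_of_facts (hP : cupLogInjective_and_hasDualExp_of_isDeRham)
    (hDR : isDeRham_restrictedRationalTateRep) (hT : exists_smul_range_expStarCoord_iff_trace_log)
    (hKatoDefPos : ∀ (W : WeierstrassCurve ℚ) [W.IsElliptic] [W.IsGloballyMinimal]
      [ContinuousSMul ℤ_[3] (W.tateModule 3)] [Module.Free ℤ_[3] (W.tateModule 3)]
      [Module.Finite ℤ_[3] (W.tateModule 3)],
      (∀ m : ℕ, W.HasSurjectiveModNGaloisRep (3 ^ m : ℕ)) →
      (haveI : Fact (Nat.Prime 3) := ⟨Nat.prime_three⟩; Addv W 3) →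
      ¬ 3 ∣ (W.baseChange ℚ_[3]).localTamagawaNumber ℤ_[3] →
      Nat.card {Q : (W.baseChange ℚ_[3]).toAffine.Point // (3 : ℕ) • Q = 0} = 1 →
      ∀ {N : ℕ} [NeZero N] (P : ModularParametrizationData W N), N = W.conductorNorm ℤ →
        (∀ z ∈ P.L.lattice, ∃ w ∈ periodLattice P.f, z = P.c * w) →
        ¬ (3 : ℤ) ∣ P.maninConstant →
        haveI : Fact (((3 : ℕ) : 𝓞 ℚ) ∈ ((Rat.HeightOneSpectrum.primesEquiv (R := 𝓞 ℚ)).symm ⟨3, Fact.out⟩).asIdeal) :=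
          ⟨(natCast_mem_asIdeal_iff_eq_primesEquiv_symm _ Nat.prime_three).mpr rfl⟩
        letI := valuativeRelPlace ((Rat.HeightOneSpectrum.primesEquiv (R := 𝓞 ℚ)).symm ⟨3, Fact.out⟩)
        letI := topologicalSpacePlace ((Rat.HeightOneSpectrum.primesEquiv (R := 𝓞 ℚ)).symm ⟨3, Fact.out⟩)
        haveI := isNonarchimedeanLocalField_place ((Rat.HeightOneSpectrum.primesEquiv (R := 𝓞 ℚ)).symm ⟨3, Fact.out⟩)
        haveI := charZero_place ((Rat.HeightOneSpectrum.primesEquiv (R := 𝓞 ℚ)).symm ⟨3, Fact.out⟩)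
        letI := padicAlgebraPlace 3 ((Rat.HeightOneSpectrum.primesEquiv (R := 𝓞 ℚ)).symm ⟨3, Fact.out⟩)
        haveI := fact_not_isUnit_place 3 ((Rat.HeightOneSpectrum.primesEquiv (R := 𝓞 ℚ)).symm ⟨3, Fact.out⟩)
        haveI := isAdicComplete_place 3 ((Rat.HeightOneSpectrum.primesEquiv (R := 𝓞 ℚ)).symm ⟨3, Fact.out⟩)
        ∃ (d : LocalNeronLineAt W 3 ((Rat.HeightOneSpectrum.primesEquiv (R := 𝓞 ℚ)).symm ⟨3, Fact.out⟩)),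
        ∃ (ι : (n : ℕ) → (CyclotomicField n ℚ →+* ℂ)) (κK : ℝ)
          (Ψ : ∀ (k' : ℕ) (r : Finset (HeightOneSpectrum (𝓞 ℚ))), ℚ_[3] ⊗[ℚ] CyclotomicField (cycLevel 3 k' r) ℚ ≃ₐ[ℚ]
            (Π w : (((Rat.HeightOneSpectrum.primesEquiv (R := 𝓞 ℚ)).symm ⟨3, Fact.out⟩).Extension (𝓞 (CyclotomicField (cycLevel 3 k' r) ℚ))), w.1.adicCompletion (CyclotomicField (cycLevel 3 k' r) ℚ)))
          (hΨ : ∀ (k' : ℕ) (r : Finset (HeightOneSpectrum (𝓞 ℚ))) (s : ℚ_[3]) (x : CyclotomicField (cycLevel 3 k' r) ℚ) (w : (((Rat.HeightOneSpectrum.primesEquiv (R := 𝓞 ℚ)).symm ⟨3, Fact.out⟩).Extension (𝓞 (CyclotomicField (cycLevel 3 k' r) ℚ)))),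
            Ψ k' r (s ⊗ₜ[ℚ] x) w = algebraMap (CyclotomicField (cycLevel 3 k' r) ℚ) (w.1.adicCompletion (CyclotomicField (cycLevel 3 k' r) ℚ)) x *
              algebraMap (((Rat.HeightOneSpectrum.primesEquiv (R := 𝓞 ℚ)).symm ⟨3, Fact.out⟩).adicCompletion ℚ) (w.1.adicCompletion (CyclotomicField (cycLevel 3 k' r) ℚ)) ((Padic.adicCompletionEquiv (𝓞 ℚ) ⟨3, Fact.out⟩) s))
          (w₀ : ∀ (k' : ℕ) (r : Finset (HeightOneSpectrum (𝓞 ℚ))), (((Rat.HeightOneSpectrum.primesEquiv (R := 𝓞 ℚ)).symm ⟨3, Fact.out⟩).Extension (𝓞 (CyclotomicField (cycLevel 3 k' r) ℚ))))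
          (g : ∀ (k' : ℕ) (r : Finset (HeightOneSpectrum (𝓞 ℚ))), (((Rat.HeightOneSpectrum.primesEquiv (R := 𝓞 ℚ)).symm ⟨3, Fact.out⟩).Extension (𝓞 (CyclotomicField (cycLevel 3 k' r) ℚ))) → absoluteGaloisGroup ℚ)
          (hg : ∀ (k' : ℕ) (r : Finset (HeightOneSpectrum (𝓞 ℚ))) (w : (((Rat.HeightOneSpectrum.primesEquiv (R := 𝓞 ℚ)).symm ⟨3, Fact.out⟩).Extension (𝓞 (CyclotomicField (cycLevel 3 k' r) ℚ)))),
            sigma (cycLevel 3 k' r) (modNCyclotomicCharacter ℚ (cycLevel 3 k' r) (g k' r w)) • w.1 = (w₀ k' r).1)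
          (dw : ∀ (k' : ℕ) (r : Finset (HeightOneSpectrum (𝓞 ℚ))),
            letI := LocalField.charZero_adicCompletion (w₀ k' r).1
            letI := LocalField.adicCompletionPadicAlgebra (w₀ k' r).1 3 (three_mem_asIdeal_extension _ (w₀ k' r))
            haveI : Fact (¬ IsUnit ((3 : ℕ) : integerC ((w₀ k' r).1.adicCompletion (CyclotomicField (cycLevel 3 k' r) ℚ)))) := ⟨not_isUnit_natCast_integerC (LocalField.valuation_adicCompletion_natCast_lt_one (w₀ k' r).1 3 (three_mem_asIdeal_extension _ (w₀ k' r)))⟩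
            haveI := isAdicComplete_integerC_natCast (LocalField.valuation_adicCompletion_natCast_lt_one (w₀ k' r).1 3 (three_mem_asIdeal_extension _ (w₀ k' r)))
            LocalNeronLine W (LocalField.valuation_adicCompletion_natCast_lt_one (w₀ k' r).1 3 (three_mem_asIdeal_extension _ (w₀ k' r))) ((galRestrictPlace ((Rat.HeightOneSpectrum.primesEquiv (R := 𝓞 ℚ)).symm ⟨3, Fact.out⟩)).comp (absGaloisRestrict (((Rat.HeightOneSpectrum.primesEquiv (R := 𝓞 ℚ)).symm ⟨3, Fact.out⟩).adicCompletion ℚ) ((w₀ k' r).1.adicCompletion (CyclotomicField (cycLevel 3 k' r) ℚ)))))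
          (hinjw : ∀ (k' : ℕ) (r : Finset (HeightOneSpectrum (𝓞 ℚ))),
            letI := LocalField.charZero_adicCompletion (w₀ k' r).1
            letI := LocalField.adicCompletionPadicAlgebra (w₀ k' r).1 3 (three_mem_asIdeal_extension _ (w₀ k' r))
            haveI : Fact (¬ IsUnit ((3 : ℕ) : integerC ((w₀ k' r).1.adicCompletion (CyclotomicField (cycLevel 3 k' r) ℚ)))) := ⟨not_isUnit_natCast_integerC (LocalField.valuation_adicCompletion_natCast_lt_one (w₀ k' r).1 3 (three_mem_asIdeal_extension _ (w₀ k' r)))⟩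
            haveI := isAdicComplete_integerC_natCast (LocalField.valuation_adicCompletion_natCast_lt_one (w₀ k' r).1 3 (three_mem_asIdeal_extension _ (w₀ k' r)))
            (bdRPeriodRingData (LocalField.valuation_adicCompletion_natCast_lt_one (w₀ k' r).1 3 (three_mem_asIdeal_extension _ (w₀ k' r)))).CupLogInjective (logCyclotomic 3) (localRationalTateRep W 3 ((galRestrictPlace ((Rat.HeightOneSpectrum.primesEquiv (R := 𝓞 ℚ)).symm ⟨3, Fact.out⟩)).comp (absGaloisRestrict (((Rat.HeightOneSpectrum.primesEquiv (R := 𝓞 ℚ)).symm ⟨3, Fact.out⟩).adicCompletion ℚ) ((w₀ k' r).1.adicCompletion (CyclotomicField (cycLevel 3 k' r) ℚ))))))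
          (hexw : ∀ (k' : ℕ) (r : Finset (HeightOneSpectrum (𝓞 ℚ))),
            letI := LocalField.charZero_adicCompletion (w₀ k' r).1
            letI := LocalField.adicCompletionPadicAlgebra (w₀ k' r).1 3 (three_mem_asIdeal_extension _ (w₀ k' r))
            haveI : Fact (¬ IsUnit ((3 : ℕ) : integerC ((w₀ k' r).1.adicCompletion (CyclotomicField (cycLevel 3 k' r) ℚ)))) := ⟨not_isUnit_natCast_integerC (LocalField.valuation_adicCompletion_natCast_lt_one (w₀ k' r).1 3 (three_mem_asIdeal_extension _ (w₀ k' r)))⟩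
            haveI := isAdicComplete_integerC_natCast (LocalField.valuation_adicCompletion_natCast_lt_one (w₀ k' r).1 3 (three_mem_asIdeal_extension _ (w₀ k' r)))
            ∀ z : contOneCocycles (localRationalTateRep W 3 ((galRestrictPlace ((Rat.HeightOneSpectrum.primesEquiv (R := 𝓞 ℚ)).symm ⟨3, Fact.out⟩)).comp (absGaloisRestrict (((Rat.HeightOneSpectrum.primesEquiv (R := 𝓞 ℚ)).symm ⟨3, Fact.out⟩).adicCompletion ℚ) ((w₀ k' r).1.adicCompletion (CyclotomicField (cycLevel 3 k' r) ℚ))))).toTopRep,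
              (bdRPeriodRingData (LocalField.valuation_adicCompletion_natCast_lt_one (w₀ k' r).1 3 (three_mem_asIdeal_extension _ (w₀ k' r)))).HasDualExp (logCyclotomic 3) (localRationalTateRep W 3 ((galRestrictPlace ((Rat.HeightOneSpectrum.primesEquiv (R := 𝓞 ℚ)).symm ⟨3, Fact.out⟩)).comp (absGaloisRestrict (((Rat.HeightOneSpectrum.primesEquiv (R := 𝓞 ℚ)).symm ⟨3, Fact.out⟩).adicCompletion ℚ) ((w₀ k' r).1.adicCompletion (CyclotomicField (cycLevel 3 k' r) ℚ))))) fun σ => z.1 σ),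
          κK ≠ 0 ∧
          (∃ u : ℚ, (u : ℝ) = κK ∧
            ∀ (hinj : (bdRPeriodRingData (valuation_place_lt_one 3 ((Rat.HeightOneSpectrum.primesEquiv (R := 𝓞 ℚ)).symm ⟨3, Fact.out⟩))).CupLogInjective (logCyclotomic 3)
            (localRationalTateRep W 3 (galRestrictPlace ((Rat.HeightOneSpectrum.primesEquiv (R := 𝓞 ℚ)).symm ⟨3, Fact.out⟩))))
            (hex : ∀ z : contOneCocycles (localRationalTateRep W 3 (galRestrictPlace ((Rat.HeightOneSpectrum.primesEquiv (R := 𝓞 ℚ)).symm ⟨3, Fact.out⟩))).toTopRep,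
            (bdRPeriodRingData (valuation_place_lt_one 3 ((Rat.HeightOneSpectrum.primesEquiv (R := 𝓞 ℚ)).symm ⟨3, Fact.out⟩))).HasDualExp (logCyclotomic 3)
            (localRationalTateRep W 3 (galRestrictPlace ((Rat.HeightOneSpectrum.primesEquiv (R := 𝓞 ℚ)).symm ⟨3, Fact.out⟩))) fun σ => z.1 σ)
              (e : ((Rat.HeightOneSpectrum.primesEquiv (R := 𝓞 ℚ)).symm ⟨3, Fact.out⟩).adicCompletion ℚ) (he : e ≠ 0),
              (∀ a : ℚ_[3], (∃ y, (expStarOmegaPadicAt (d.smul e he) hinj hex (((Padic.adicCompletionEquiv (𝓞 ℚ) ⟨3, Fact.out⟩).symm : (((Rat.HeightOneSpectrum.primesEquiv (R := 𝓞 ℚ)).symm ⟨3, Fact.out⟩).adicCompletion ℚ) →+* ℚ_[3]))) y = a) ↔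
                ∀ Q : (W.baseChange ℚ_[3]).toAffine.Point, ‖a * padicLog (W.baseChange ℚ_[3]) Q‖ ≤ 1) →
              padicValRat 3 u = ((((Padic.adicCompletionEquiv (𝓞 ℚ) ⟨3, Fact.out⟩).symm : (((Rat.HeightOneSpectrum.primesEquiv (R := 𝓞 ℚ)).symm ⟨3, Fact.out⟩).adicCompletion ℚ) →+* ℚ_[3])) e).valuation) ∧
          (∀ (k' : ℕ) (r : Finset (HeightOneSpectrum (𝓞 ℚ))),
            letI := LocalField.charZero_adicCompletion (w₀ k' r).1
            letI := LocalField.adicCompletionPadicAlgebra (w₀ k' r).1 3 (three_mem_asIdeal_extension _ (w₀ k' r))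
            haveI : Fact (¬ IsUnit ((3 : ℕ) : integerC ((w₀ k' r).1.adicCompletion (CyclotomicField (cycLevel 3 k' r) ℚ)))) := ⟨not_isUnit_natCast_integerC (LocalField.valuation_adicCompletion_natCast_lt_one (w₀ k' r).1 3 (three_mem_asIdeal_extension _ (w₀ k' r)))⟩
            haveI := isAdicComplete_integerC_natCast (LocalField.valuation_adicCompletion_natCast_lt_one (w₀ k' r).1 3 (three_mem_asIdeal_extension _ (w₀ k' r)))
            ∀ (h : (tateLocalRep W 3 (Sum.inr ((Rat.HeightOneSpectrum.primesEquiv (R := 𝓞 ℚ)).symm ⟨3, Fact.out⟩))).cohomology 1),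
              expStarOmegaHom (LocalField.valuation_adicCompletion_natCast_lt_one (w₀ k' r).1 3 (three_mem_asIdeal_extension _ (w₀ k' r))) ((galRestrictPlace ((Rat.HeightOneSpectrum.primesEquiv (R := 𝓞 ℚ)).symm ⟨3, Fact.out⟩)).comp (absGaloisRestrict (((Rat.HeightOneSpectrum.primesEquiv (R := 𝓞 ℚ)).symm ⟨3, Fact.out⟩).adicCompletion ℚ) ((w₀ k' r).1.adicCompletion (CyclotomicField (cycLevel 3 k' r) ℚ)))) (dw k' r) (hinjw k' r) (hexw k' r)
                (ContinuousRep.cohomologyRes (tateLocalRep W 3 (Sum.inr ((Rat.HeightOneSpectrum.primesEquiv (R := 𝓞 ℚ)).symm ⟨3, Fact.out⟩))) (absGaloisRestrict (((Rat.HeightOneSpectrum.primesEquiv (R := 𝓞 ℚ)).symm ⟨3, Fact.out⟩).adicCompletion ℚ) ((w₀ k' r).1.adicCompletion (CyclotomicField (cycLevel 3 k' r) ℚ))) 1 h) =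
              algebraMap (((Rat.HeightOneSpectrum.primesEquiv (R := 𝓞 ℚ)).symm ⟨3, Fact.out⟩).adicCompletion ℚ) ((w₀ k' r).1.adicCompletion (CyclotomicField (cycLevel 3 k' r) ℚ)) (expStarOmegaAt d h)) ∧
          ∀ (c d a : ℤ) (A : ℕ), 0 < A → Int.gcd c (6 * 3 * A) = 1 → Int.gcd d (6 * 3 * N) = 1 →
            ∃ (z : ∀ (k' : ℕ) (r : (cyclotomicLevelsRat 3 (badPlaces c d A N)).Ideals),
                  H1 (tateRep W 3) ((cyclotomicLevelsRat 3 (badPlaces c d A N)).level k' r.1))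
              (x : ∀ (k' : ℕ) (r : (cyclotomicLevelsRat 3 (badPlaces c d A N)).Ideals),
                  CyclotomicField (cycLevel 3 k' r.1) ℚ),
              ZetaBody W 3 P.f ι κK
                (fun k' r => katoLambda W 3 k' r (w₀ k' r) (Ψ k' r) (hΨ k' r) (three_mem_asIdeal_extension _ (w₀ k' r)) (g k' r) (hg k' r) (dw k' r) (hinjw k' r) (hexw k' r))
                c d a A z x) :
    ∀ (W : WeierstrassCurve ℚ) [W.IsElliptic] [W.IsGloballyMinimal]
      [ContinuousSMul ℤ_[3] (W.tateModule 3)] [Module.Free ℤ_[3] (W.tateModule 3)]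
      [Module.Finite ℤ_[3] (W.tateModule 3)],
      (∀ m : ℕ, W.HasSurjectiveModNGaloisRep (3 ^ m : ℕ)) →
      (haveI : Fact (Nat.Prime 3) := ⟨Nat.prime_three⟩; Addv W 3) →
      ¬ 3 ∣ (W.baseChange ℚ_[3]).localTamagawaNumber ℤ_[3] →
      Nat.card {Q : (W.baseChange ℚ_[3]).toAffine.Point // (3 : ℕ) • Q = 0} = 1 →
      ∀ {N : ℕ} [NeZero N] (P : ModularParametrizationData W N), N = W.conductorNorm ℤ →
        (∀ z ∈ P.L.lattice, ∃ w ∈ periodLattice P.f, z = P.c * w) →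
        ¬ (3 : ℤ) ∣ P.maninConstant →
        haveI : Fact (((3 : ℕ) : 𝓞 ℚ) ∈ ((Rat.HeightOneSpectrum.primesEquiv (R := 𝓞 ℚ)).symm ⟨3, Fact.out⟩).asIdeal) :=
          ⟨(natCast_mem_asIdeal_iff_eq_primesEquiv_symm _ Nat.prime_three).mpr rfl⟩
        letI := valuativeRelPlace ((Rat.HeightOneSpectrum.primesEquiv (R := 𝓞 ℚ)).symm ⟨3, Fact.out⟩)
        letI := topologicalSpacePlace ((Rat.HeightOneSpectrum.primesEquiv (R := 𝓞 ℚ)).symm ⟨3, Fact.out⟩)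
        haveI := isNonarchimedeanLocalField_place ((Rat.HeightOneSpectrum.primesEquiv (R := 𝓞 ℚ)).symm ⟨3, Fact.out⟩)
        haveI := charZero_place ((Rat.HeightOneSpectrum.primesEquiv (R := 𝓞 ℚ)).symm ⟨3, Fact.out⟩)
        letI := padicAlgebraPlace 3 ((Rat.HeightOneSpectrum.primesEquiv (R := 𝓞 ℚ)).symm ⟨3, Fact.out⟩)
        haveI := fact_not_isUnit_place 3 ((Rat.HeightOneSpectrum.primesEquiv (R := 𝓞 ℚ)).symm ⟨3, Fact.out⟩)
        haveI := isAdicComplete_place 3 ((Rat.HeightOneSpectrum.primesEquiv (R := 𝓞 ℚ)).symm ⟨3, Fact.out⟩)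
        ∃ (d : LocalNeronLineAt W 3 ((Rat.HeightOneSpectrum.primesEquiv (R := 𝓞 ℚ)).symm ⟨3, Fact.out⟩))
          (hinj : (bdRPeriodRingData (valuation_place_lt_one 3 ((Rat.HeightOneSpectrum.primesEquiv (R := 𝓞 ℚ)).symm ⟨3, Fact.out⟩))).CupLogInjective (logCyclotomic 3)
            (localRationalTateRep W 3 (galRestrictPlace ((Rat.HeightOneSpectrum.primesEquiv (R := 𝓞 ℚ)).symm ⟨3, Fact.out⟩))))
          (hex : ∀ z : contOneCocycles (localRationalTateRep W 3 (galRestrictPlace ((Rat.HeightOneSpectrum.primesEquiv (R := 𝓞 ℚ)).symm ⟨3, Fact.out⟩))).toTopRep,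
            (bdRPeriodRingData (valuation_place_lt_one 3 ((Rat.HeightOneSpectrum.primesEquiv (R := 𝓞 ℚ)).symm ⟨3, Fact.out⟩))).HasDualExp (logCyclotomic 3)
              (localRationalTateRep W 3 (galRestrictPlace ((Rat.HeightOneSpectrum.primesEquiv (R := 𝓞 ℚ)).symm ⟨3, Fact.out⟩))) fun σ => z.1 σ),
          (∀ a : ℚ_[3], (∃ y, (expStarOmegaPadicAt d hinj hex (((Padic.adicCompletionEquiv (𝓞 ℚ) ⟨3, Fact.out⟩).symm : (((Rat.HeightOneSpectrum.primesEquiv (R := 𝓞 ℚ)).symm ⟨3, Fact.out⟩).adicCompletion ℚ) →+* ℚ_[3]))) y = a) ↔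
            ∀ Q : (W.baseChange ℚ_[3]).toAffine.Point, ‖a * padicLog (W.baseChange ℚ_[3]) Q‖ ≤ 1) ∧
        ∃ (ι : (n : ℕ) → (CyclotomicField n ℚ →+* ℂ)) (κK : ℝ)
          (Ψ : ∀ (k' : ℕ) (r : Finset (HeightOneSpectrum (𝓞 ℚ))), ℚ_[3] ⊗[ℚ] CyclotomicField (cycLevel 3 k' r) ℚ ≃ₐ[ℚ]
            (Π w : (((Rat.HeightOneSpectrum.primesEquiv (R := 𝓞 ℚ)).symm ⟨3, Fact.out⟩).Extension (𝓞 (CyclotomicField (cycLevel 3 k' r) ℚ))), w.1.adicCompletion (CyclotomicField (cycLevel 3 k' r) ℚ)))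
          (hΨ : ∀ (k' : ℕ) (r : Finset (HeightOneSpectrum (𝓞 ℚ))) (s : ℚ_[3]) (x : CyclotomicField (cycLevel 3 k' r) ℚ) (w : (((Rat.HeightOneSpectrum.primesEquiv (R := 𝓞 ℚ)).symm ⟨3, Fact.out⟩).Extension (𝓞 (CyclotomicField (cycLevel 3 k' r) ℚ)))),
            Ψ k' r (s ⊗ₜ[ℚ] x) w = algebraMap (CyclotomicField (cycLevel 3 k' r) ℚ) (w.1.adicCompletion (CyclotomicField (cycLevel 3 k' r) ℚ)) x *
              algebraMap (((Rat.HeightOneSpectrum.primesEquiv (R := 𝓞 ℚ)).symm ⟨3, Fact.out⟩).adicCompletion ℚ) (w.1.adicCompletion (CyclotomicField (cycLevel 3 k' r) ℚ)) ((Padic.adicCompletionEquiv (𝓞 ℚ) ⟨3, Fact.out⟩) s))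
          (w₀ : ∀ (k' : ℕ) (r : Finset (HeightOneSpectrum (𝓞 ℚ))), (((Rat.HeightOneSpectrum.primesEquiv (R := 𝓞 ℚ)).symm ⟨3, Fact.out⟩).Extension (𝓞 (CyclotomicField (cycLevel 3 k' r) ℚ))))
          (g : ∀ (k' : ℕ) (r : Finset (HeightOneSpectrum (𝓞 ℚ))), (((Rat.HeightOneSpectrum.primesEquiv (R := 𝓞 ℚ)).symm ⟨3, Fact.out⟩).Extension (𝓞 (CyclotomicField (cycLevel 3 k' r) ℚ))) → absoluteGaloisGroup ℚ)
          (hg : ∀ (k' : ℕ) (r : Finset (HeightOneSpectrum (𝓞 ℚ))) (w : (((Rat.HeightOneSpectrum.primesEquiv (R := 𝓞 ℚ)).symm ⟨3, Fact.out⟩).Extension (𝓞 (CyclotomicField (cycLevel 3 k' r) ℚ)))),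
            sigma (cycLevel 3 k' r) (modNCyclotomicCharacter ℚ (cycLevel 3 k' r) (g k' r w)) • w.1 = (w₀ k' r).1)
          (dw : ∀ (k' : ℕ) (r : Finset (HeightOneSpectrum (𝓞 ℚ))),
            letI := LocalField.charZero_adicCompletion (w₀ k' r).1
            letI := LocalField.adicCompletionPadicAlgebra (w₀ k' r).1 3 (three_mem_asIdeal_extension _ (w₀ k' r))
            haveI : Fact (¬ IsUnit ((3 : ℕ) : integerC ((w₀ k' r).1.adicCompletion (CyclotomicField (cycLevel 3 k' r) ℚ)))) := ⟨not_isUnit_natCast_integerC (LocalField.valuation_adicCompletion_natCast_lt_one (w₀ k' r).1 3 (three_mem_asIdeal_extension _ (w₀ k' r)))⟩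
            haveI := isAdicComplete_integerC_natCast (LocalField.valuation_adicCompletion_natCast_lt_one (w₀ k' r).1 3 (three_mem_asIdeal_extension _ (w₀ k' r)))
            LocalNeronLine W (LocalField.valuation_adicCompletion_natCast_lt_one (w₀ k' r).1 3 (three_mem_asIdeal_extension _ (w₀ k' r))) ((galRestrictPlace ((Rat.HeightOneSpectrum.primesEquiv (R := 𝓞 ℚ)).symm ⟨3, Fact.out⟩)).comp (absGaloisRestrict (((Rat.HeightOneSpectrum.primesEquiv (R := 𝓞 ℚ)).symm ⟨3, Fact.out⟩).adicCompletion ℚ) ((w₀ k' r).1.adicCompletion (CyclotomicField (cycLevel 3 k' r) ℚ)))))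
          (hinjw : ∀ (k' : ℕ) (r : Finset (HeightOneSpectrum (𝓞 ℚ))),
            letI := LocalField.charZero_adicCompletion (w₀ k' r).1
            letI := LocalField.adicCompletionPadicAlgebra (w₀ k' r).1 3 (three_mem_asIdeal_extension _ (w₀ k' r))
            haveI : Fact (¬ IsUnit ((3 : ℕ) : integerC ((w₀ k' r).1.adicCompletion (CyclotomicField (cycLevel 3 k' r) ℚ)))) := ⟨not_isUnit_natCast_integerC (LocalField.valuation_adicCompletion_natCast_lt_one (w₀ k' r).1 3 (three_mem_asIdeal_extension _ (w₀ k' r)))⟩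
            haveI := isAdicComplete_integerC_natCast (LocalField.valuation_adicCompletion_natCast_lt_one (w₀ k' r).1 3 (three_mem_asIdeal_extension _ (w₀ k' r)))
            (bdRPeriodRingData (LocalField.valuation_adicCompletion_natCast_lt_one (w₀ k' r).1 3 (three_mem_asIdeal_extension _ (w₀ k' r)))).CupLogInjective (logCyclotomic 3) (localRationalTateRep W 3 ((galRestrictPlace ((Rat.HeightOneSpectrum.primesEquiv (R := 𝓞 ℚ)).symm ⟨3, Fact.out⟩)).comp (absGaloisRestrict (((Rat.HeightOneSpectrum.primesEquiv (R := 𝓞 ℚ)).symm ⟨3, Fact.out⟩).adicCompletion ℚ) ((w₀ k' r).1.adicCompletion (CyclotomicField (cycLevel 3 k' r) ℚ))))))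
          (hexw : ∀ (k' : ℕ) (r : Finset (HeightOneSpectrum (𝓞 ℚ))),
            letI := LocalField.charZero_adicCompletion (w₀ k' r).1
            letI := LocalField.adicCompletionPadicAlgebra (w₀ k' r).1 3 (three_mem_asIdeal_extension _ (w₀ k' r))
            haveI : Fact (¬ IsUnit ((3 : ℕ) : integerC ((w₀ k' r).1.adicCompletion (CyclotomicField (cycLevel 3 k' r) ℚ)))) := ⟨not_isUnit_natCast_integerC (LocalField.valuation_adicCompletion_natCast_lt_one (w₀ k' r).1 3 (three_mem_asIdeal_extension _ (w₀ k' r)))⟩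
            haveI := isAdicComplete_integerC_natCast (LocalField.valuation_adicCompletion_natCast_lt_one (w₀ k' r).1 3 (three_mem_asIdeal_extension _ (w₀ k' r)))
            ∀ z : contOneCocycles (localRationalTateRep W 3 ((galRestrictPlace ((Rat.HeightOneSpectrum.primesEquiv (R := 𝓞 ℚ)).symm ⟨3, Fact.out⟩)).comp (absGaloisRestrict (((Rat.HeightOneSpectrum.primesEquiv (R := 𝓞 ℚ)).symm ⟨3, Fact.out⟩).adicCompletion ℚ) ((w₀ k' r).1.adicCompletion (CyclotomicField (cycLevel 3 k' r) ℚ))))).toTopRep,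
              (bdRPeriodRingData (LocalField.valuation_adicCompletion_natCast_lt_one (w₀ k' r).1 3 (three_mem_asIdeal_extension _ (w₀ k' r)))).HasDualExp (logCyclotomic 3) (localRationalTateRep W 3 ((galRestrictPlace ((Rat.HeightOneSpectrum.primesEquiv (R := 𝓞 ℚ)).symm ⟨3, Fact.out⟩)).comp (absGaloisRestrict (((Rat.HeightOneSpectrum.primesEquiv (R := 𝓞 ℚ)).symm ⟨3, Fact.out⟩).adicCompletion ℚ) ((w₀ k' r).1.adicCompletion (CyclotomicField (cycLevel 3 k' r) ℚ))))) fun σ => z.1 σ),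
          κK ≠ 0 ∧ (∃ u : ℚ, (u : ℝ) = κK ∧ padicValRat 3 u = 0) ∧
          (∀ (k' : ℕ) (r : Finset (HeightOneSpectrum (𝓞 ℚ))),
            letI := LocalField.charZero_adicCompletion (w₀ k' r).1
            letI := LocalField.adicCompletionPadicAlgebra (w₀ k' r).1 3 (three_mem_asIdeal_extension _ (w₀ k' r))
            haveI : Fact (¬ IsUnit ((3 : ℕ) : integerC ((w₀ k' r).1.adicCompletion (CyclotomicField (cycLevel 3 k' r) ℚ)))) := ⟨not_isUnit_natCast_integerC (LocalField.valuation_adicCompletion_natCast_lt_one (w₀ k' r).1 3 (three_mem_asIdeal_extension _ (w₀ k' r)))⟩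
            haveI := isAdicComplete_integerC_natCast (LocalField.valuation_adicCompletion_natCast_lt_one (w₀ k' r).1 3 (three_mem_asIdeal_extension _ (w₀ k' r)))
            ∀ (h : (tateLocalRep W 3 (Sum.inr ((Rat.HeightOneSpectrum.primesEquiv (R := 𝓞 ℚ)).symm ⟨3, Fact.out⟩))).cohomology 1),
              expStarOmegaHom (LocalField.valuation_adicCompletion_natCast_lt_one (w₀ k' r).1 3 (three_mem_asIdeal_extension _ (w₀ k' r))) ((galRestrictPlace ((Rat.HeightOneSpectrum.primesEquiv (R := 𝓞 ℚ)).symm ⟨3, Fact.out⟩)).comp (absGaloisRestrict (((Rat.HeightOneSpectrum.primesEquiv (R := 𝓞 ℚ)).symm ⟨3, Fact.out⟩).adicCompletion ℚ) ((w₀ k' r).1.adicCompletion (CyclotomicField (cycLevel 3 k' r) ℚ)))) (dw k' r) (hinjw k' r) (hexw k' r)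
                (ContinuousRep.cohomologyRes (tateLocalRep W 3 (Sum.inr ((Rat.HeightOneSpectrum.primesEquiv (R := 𝓞 ℚ)).symm ⟨3, Fact.out⟩))) (absGaloisRestrict (((Rat.HeightOneSpectrum.primesEquiv (R := 𝓞 ℚ)).symm ⟨3, Fact.out⟩).adicCompletion ℚ) ((w₀ k' r).1.adicCompletion (CyclotomicField (cycLevel 3 k' r) ℚ))) 1 h) =
              algebraMap (((Rat.HeightOneSpectrum.primesEquiv (R := 𝓞 ℚ)).symm ⟨3, Fact.out⟩).adicCompletion ℚ) ((w₀ k' r).1.adicCompletion (CyclotomicField (cycLevel 3 k' r) ℚ)) (expStarOmegaAt d h)) ∧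
          ∀ (c d a : ℤ) (A : ℕ), 0 < A → Int.gcd c (6 * 3 * A) = 1 → Int.gcd d (6 * 3 * N) = 1 →
            ∃ (z : ∀ (k' : ℕ) (r : (cyclotomicLevelsRat 3 (badPlaces c d A N)).Ideals),
                  H1 (tateRep W 3) ((cyclotomicLevelsRat 3 (badPlaces c d A N)).level k' r.1))
              (x : ∀ (k' : ℕ) (r : (cyclotomicLevelsRat 3 (badPlaces c d A N)).Ideals),
                  CyclotomicField (cycLevel 3 k' r.1) ℚ),
              ZetaBody W 3 P.f ι κK
                (fun k' r => katoLambda W 3 k' r (w₀ k' r) (Ψ k' r) (hΨ k' r) (three_mem_asIdeal_extension _ (w₀ k' r)) (g k' r) (hg k' r) (dw k' r) (hinjw k' r) (hexw k' r))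
                c d a A z x := by
  intro W _ _ _ _ _ htow hadd hc3 ht N _ P hN hlat hman
  haveI : Fact (((3 : ℕ) : 𝓞 ℚ) ∈ ((Rat.HeightOneSpectrum.primesEquiv (R := 𝓞 ℚ)).symm ⟨3, Fact.out⟩).asIdeal) :=
    ⟨(natCast_mem_asIdeal_iff_eq_primesEquiv_symm _ Nat.prime_three).mpr rfl⟩
  letI := valuativeRelPlace ((Rat.HeightOneSpectrum.primesEquiv (R := 𝓞 ℚ)).symm ⟨3, Fact.out⟩)
  letI := topologicalSpacePlace ((Rat.HeightOneSpectrum.primesEquiv (R := 𝓞 ℚ)).symm ⟨3, Fact.out⟩)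
  haveI := isNonarchimedeanLocalField_place ((Rat.HeightOneSpectrum.primesEquiv (R := 𝓞 ℚ)).symm ⟨3, Fact.out⟩)
  haveI := charZero_place ((Rat.HeightOneSpectrum.primesEquiv (R := 𝓞 ℚ)).symm ⟨3, Fact.out⟩)
  letI := padicAlgebraPlace 3 ((Rat.HeightOneSpectrum.primesEquiv (R := 𝓞 ℚ)).symm ⟨3, Fact.out⟩)
  haveI := fact_not_isUnit_place 3 ((Rat.HeightOneSpectrum.primesEquiv (R := 𝓞 ℚ)).symm ⟨3, Fact.out⟩)
  haveI := isAdicComplete_place 3 ((Rat.HeightOneSpectrum.primesEquiv (R := 𝓞 ℚ)).symm ⟨3, Fact.out⟩)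
  obtain ⟨dK, ι, κK, Ψ, hΨ, w₀, g, hg, dw, hinjw, hexw, hκ0, hpos, hres, hz⟩ := hKatoDefPos W htow hadd hc3 ht P hN hlat hman
  have key := exists_dual_unit_of_position W 3 ((Rat.HeightOneSpectrum.primesEquiv (R := 𝓞 ℚ)).symm ⟨3, Fact.out⟩)
    hP hDR hT
    (((Padic.adicCompletionEquiv (𝓞 ℚ) ⟨3, Fact.out⟩).symm : (((Rat.HeightOneSpectrum.primesEquiv (R := 𝓞 ℚ)).symm ⟨3, Fact.out⟩).adicCompletion ℚ) →+* ℚ_[3]))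
    (fun (d : LocalNeronLineAt W 3 ((Rat.HeightOneSpectrum.primesEquiv (R := 𝓞 ℚ)).symm ⟨3, Fact.out⟩)) (κK : ℝ) =>
        ∃ (ι : (n : ℕ) → (CyclotomicField n ℚ →+* ℂ))
          (Ψ : ∀ (k' : ℕ) (r : Finset (HeightOneSpectrum (𝓞 ℚ))), ℚ_[3] ⊗[ℚ] CyclotomicField (cycLevel 3 k' r) ℚ ≃ₐ[ℚ]
            (Π w : (((Rat.HeightOneSpectrum.primesEquiv (R := 𝓞 ℚ)).symm ⟨3, Fact.out⟩).Extension (𝓞 (CyclotomicField (cycLevel 3 k' r) ℚ))), w.1.adicCompletion (CyclotomicField (cycLevel 3 k' r) ℚ)))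
          (hΨ : ∀ (k' : ℕ) (r : Finset (HeightOneSpectrum (𝓞 ℚ))) (s : ℚ_[3]) (x : CyclotomicField (cycLevel 3 k' r) ℚ) (w : (((Rat.HeightOneSpectrum.primesEquiv (R := 𝓞 ℚ)).symm ⟨3, Fact.out⟩).Extension (𝓞 (CyclotomicField (cycLevel 3 k' r) ℚ)))),
            Ψ k' r (s ⊗ₜ[ℚ] x) w = algebraMap (CyclotomicField (cycLevel 3 k' r) ℚ) (w.1.adicCompletion (CyclotomicField (cycLevel 3 k' r) ℚ)) x *
              algebraMap (((Rat.HeightOneSpectrum.primesEquiv (R := 𝓞 ℚ)).symm ⟨3, Fact.out⟩).adicCompletion ℚ) (w.1.adicCompletion (CyclotomicField (cycLevel 3 k' r) ℚ)) ((Padic.adicCompletionEquiv (𝓞 ℚ) ⟨3, Fact.out⟩) s))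
          (w₀ : ∀ (k' : ℕ) (r : Finset (HeightOneSpectrum (𝓞 ℚ))), (((Rat.HeightOneSpectrum.primesEquiv (R := 𝓞 ℚ)).symm ⟨3, Fact.out⟩).Extension (𝓞 (CyclotomicField (cycLevel 3 k' r) ℚ))))
          (g : ∀ (k' : ℕ) (r : Finset (HeightOneSpectrum (𝓞 ℚ))), (((Rat.HeightOneSpectrum.primesEquiv (R := 𝓞 ℚ)).symm ⟨3, Fact.out⟩).Extension (𝓞 (CyclotomicField (cycLevel 3 k' r) ℚ))) → absoluteGaloisGroup ℚ)
          (hg : ∀ (k' : ℕ) (r : Finset (HeightOneSpectrum (𝓞 ℚ))) (w : (((Rat.HeightOneSpectrum.primesEquiv (R := 𝓞 ℚ)).symm ⟨3, Fact.out⟩).Extension (𝓞 (CyclotomicField (cycLevel 3 k' r) ℚ)))),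
            sigma (cycLevel 3 k' r) (modNCyclotomicCharacter ℚ (cycLevel 3 k' r) (g k' r w)) • w.1 = (w₀ k' r).1)
          (dw : ∀ (k' : ℕ) (r : Finset (HeightOneSpectrum (𝓞 ℚ))),
            letI := LocalField.charZero_adicCompletion (w₀ k' r).1
            letI := LocalField.adicCompletionPadicAlgebra (w₀ k' r).1 3 (three_mem_asIdeal_extension _ (w₀ k' r))
            haveI : Fact (¬ IsUnit ((3 : ℕ) : integerC ((w₀ k' r).1.adicCompletion (CyclotomicField (cycLevel 3 k' r) ℚ)))) := ⟨not_isUnit_natCast_integerC (LocalField.valuation_adicCompletion_natCast_lt_one (w₀ k' r).1 3 (three_mem_asIdeal_extension _ (w₀ k' r)))⟩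
            haveI := isAdicComplete_integerC_natCast (LocalField.valuation_adicCompletion_natCast_lt_one (w₀ k' r).1 3 (three_mem_asIdeal_extension _ (w₀ k' r)))
            LocalNeronLine W (LocalField.valuation_adicCompletion_natCast_lt_one (w₀ k' r).1 3 (three_mem_asIdeal_extension _ (w₀ k' r))) ((galRestrictPlace ((Rat.HeightOneSpectrum.primesEquiv (R := 𝓞 ℚ)).symm ⟨3, Fact.out⟩)).comp (absGaloisRestrict (((Rat.HeightOneSpectrum.primesEquiv (R := 𝓞 ℚ)).symm ⟨3, Fact.out⟩).adicCompletion ℚ) ((w₀ k' r).1.adicCompletion (CyclotomicField (cycLevel 3 k' r) ℚ)))))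
          (hinjw : ∀ (k' : ℕ) (r : Finset (HeightOneSpectrum (𝓞 ℚ))),
            letI := LocalField.charZero_adicCompletion (w₀ k' r).1
            letI := LocalField.adicCompletionPadicAlgebra (w₀ k' r).1 3 (three_mem_asIdeal_extension _ (w₀ k' r))
            haveI : Fact (¬ IsUnit ((3 : ℕ) : integerC ((w₀ k' r).1.adicCompletion (CyclotomicField (cycLevel 3 k' r) ℚ)))) := ⟨not_isUnit_natCast_integerC (LocalField.valuation_adicCompletion_natCast_lt_one (w₀ k' r).1 3 (three_mem_asIdeal_extension _ (w₀ k' r)))⟩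
            haveI := isAdicComplete_integerC_natCast (LocalField.valuation_adicCompletion_natCast_lt_one (w₀ k' r).1 3 (three_mem_asIdeal_extension _ (w₀ k' r)))
            (bdRPeriodRingData (LocalField.valuation_adicCompletion_natCast_lt_one (w₀ k' r).1 3 (three_mem_asIdeal_extension _ (w₀ k' r)))).CupLogInjective (logCyclotomic 3) (localRationalTateRep W 3 ((galRestrictPlace ((Rat.HeightOneSpectrum.primesEquiv (R := 𝓞 ℚ)).symm ⟨3, Fact.out⟩)).comp (absGaloisRestrict (((Rat.HeightOneSpectrum.primesEquiv (R := 𝓞 ℚ)).symm ⟨3, Fact.out⟩).adicCompletion ℚ) ((w₀ k' r).1.adicCompletion (CyclotomicField (cycLevel 3 k' r) ℚ))))))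
          (hexw : ∀ (k' : ℕ) (r : Finset (HeightOneSpectrum (𝓞 ℚ))),
            letI := LocalField.charZero_adicCompletion (w₀ k' r).1
            letI := LocalField.adicCompletionPadicAlgebra (w₀ k' r).1 3 (three_mem_asIdeal_extension _ (w₀ k' r))
            haveI : Fact (¬ IsUnit ((3 : ℕ) : integerC ((w₀ k' r).1.adicCompletion (CyclotomicField (cycLevel 3 k' r) ℚ)))) := ⟨not_isUnit_natCast_integerC (LocalField.valuation_adicCompletion_natCast_lt_one (w₀ k' r).1 3 (three_mem_asIdeal_extension _ (w₀ k' r)))⟩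
            haveI := isAdicComplete_integerC_natCast (LocalField.valuation_adicCompletion_natCast_lt_one (w₀ k' r).1 3 (three_mem_asIdeal_extension _ (w₀ k' r)))
            ∀ z : contOneCocycles (localRationalTateRep W 3 ((galRestrictPlace ((Rat.HeightOneSpectrum.primesEquiv (R := 𝓞 ℚ)).symm ⟨3, Fact.out⟩)).comp (absGaloisRestrict (((Rat.HeightOneSpectrum.primesEquiv (R := 𝓞 ℚ)).symm ⟨3, Fact.out⟩).adicCompletion ℚ) ((w₀ k' r).1.adicCompletion (CyclotomicField (cycLevel 3 k' r) ℚ))))).toTopRep,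
              (bdRPeriodRingData (LocalField.valuation_adicCompletion_natCast_lt_one (w₀ k' r).1 3 (three_mem_asIdeal_extension _ (w₀ k' r)))).HasDualExp (logCyclotomic 3) (localRationalTateRep W 3 ((galRestrictPlace ((Rat.HeightOneSpectrum.primesEquiv (R := 𝓞 ℚ)).symm ⟨3, Fact.out⟩)).comp (absGaloisRestrict (((Rat.HeightOneSpectrum.primesEquiv (R := 𝓞 ℚ)).symm ⟨3, Fact.out⟩).adicCompletion ℚ) ((w₀ k' r).1.adicCompletion (CyclotomicField (cycLevel 3 k' r) ℚ))))) fun σ => z.1 σ),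
          (∀ (k' : ℕ) (r : Finset (HeightOneSpectrum (𝓞 ℚ))),
            letI := LocalField.charZero_adicCompletion (w₀ k' r).1
            letI := LocalField.adicCompletionPadicAlgebra (w₀ k' r).1 3 (three_mem_asIdeal_extension _ (w₀ k' r))
            haveI : Fact (¬ IsUnit ((3 : ℕ) : integerC ((w₀ k' r).1.adicCompletion (CyclotomicField (cycLevel 3 k' r) ℚ)))) := ⟨not_isUnit_natCast_integerC (LocalField.valuation_adicCompletion_natCast_lt_one (w₀ k' r).1 3 (three_mem_asIdeal_extension _ (w₀ k' r)))⟩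
            haveI := isAdicComplete_integerC_natCast (LocalField.valuation_adicCompletion_natCast_lt_one (w₀ k' r).1 3 (three_mem_asIdeal_extension _ (w₀ k' r)))
            ∀ (h : (tateLocalRep W 3 (Sum.inr ((Rat.HeightOneSpectrum.primesEquiv (R := 𝓞 ℚ)).symm ⟨3, Fact.out⟩))).cohomology 1),
              expStarOmegaHom (LocalField.valuation_adicCompletion_natCast_lt_one (w₀ k' r).1 3 (three_mem_asIdeal_extension _ (w₀ k' r))) ((galRestrictPlace ((Rat.HeightOneSpectrum.primesEquiv (R := 𝓞 ℚ)).symm ⟨3, Fact.out⟩)).comp (absGaloisRestrict (((Rat.HeightOneSpectrum.primesEquiv (R := 𝓞 ℚ)).symm ⟨3, Fact.out⟩).adicCompletion ℚ) ((w₀ k' r).1.adicCompletion (CyclotomicField (cycLevel 3 k' r) ℚ)))) (dw k' r) (hinjw k' r) (hexw k' r)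
                (ContinuousRep.cohomologyRes (tateLocalRep W 3 (Sum.inr ((Rat.HeightOneSpectrum.primesEquiv (R := 𝓞 ℚ)).symm ⟨3, Fact.out⟩))) (absGaloisRestrict (((Rat.HeightOneSpectrum.primesEquiv (R := 𝓞 ℚ)).symm ⟨3, Fact.out⟩).adicCompletion ℚ) ((w₀ k' r).1.adicCompletion (CyclotomicField (cycLevel 3 k' r) ℚ))) 1 h) =
              algebraMap (((Rat.HeightOneSpectrum.primesEquiv (R := 𝓞 ℚ)).symm ⟨3, Fact.out⟩).adicCompletion ℚ) ((w₀ k' r).1.adicCompletion (CyclotomicField (cycLevel 3 k' r) ℚ)) (expStarOmegaAt d h)) ∧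
          ∀ (c d a : ℤ) (A : ℕ), 0 < A → Int.gcd c (6 * 3 * A) = 1 → Int.gcd d (6 * 3 * N) = 1 →
            ∃ (z : ∀ (k' : ℕ) (r : (cyclotomicLevelsRat 3 (badPlaces c d A N)).Ideals),
                  H1 (tateRep W 3) ((cyclotomicLevelsRat 3 (badPlaces c d A N)).level k' r.1))
              (x : ∀ (k' : ℕ) (r : (cyclotomicLevelsRat 3 (badPlaces c d A N)).Ideals),
                  CyclotomicField (cycLevel 3 k' r.1) ℚ),
              ZetaBody W 3 P.f ι κK
                (fun k' r => katoLambda W 3 k' r (w₀ k' r) (Ψ k' r) (hΨ k' r) (three_mem_asIdeal_extension _ (w₀ k' r)) (g k' r) (hg k' r) (dw k' r) (hinjw k' r) (hexw k' r))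
                c d a A z x)
    ?_ ⟨dK, κK, hκ0, hpos, ι, Ψ, hΨ, w₀, g, hg, dw, hinjw, hexw, hres, hz⟩
  · obtain ⟨d, hinj, hex, hdual, κ, hκ0', hR, ι', Ψ', hΨ', w₀', g', hg', dw', hinjw', hexw', hres', hz'⟩ := key
    exact ⟨d, hinj, hex, hdual, ι', κ, Ψ', hΨ', w₀', g', hg', dw', hinjw', hexw', hκ0', hR, hres', hz'⟩
  -- COVARIANCE of the inner block under `(d, κ) ↦ (c • d, q κ)` with `ι₃ c = q⁻¹`: rescale every `dw k r` by `algebraMap c`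
  intro dK' κ' c hc q hq0 hιcq hin
  obtain ⟨ι', Ψ', hΨ', w₀', g', hg', dw', hinjw', hexw', hres', hz'⟩ := hin
  have he₃q : (Padic.adicCompletionEquiv (𝓞 ℚ) ⟨3, Fact.out⟩) (q : ℚ_[3]) = c⁻¹ := by
    have h1 := congrArg (Padic.adicCompletionEquiv (𝓞 ℚ) ⟨3, Fact.out⟩) hιcq
    rw [map_inv₀] at h1
    have h2 : (Padic.adicCompletionEquiv (𝓞 ℚ) ⟨3, Fact.out⟩)
        ((((Padic.adicCompletionEquiv (𝓞 ℚ) ⟨3, Fact.out⟩).symm : (((Rat.HeightOneSpectrum.primesEquiv (R := 𝓞 ℚ)).symm ⟨3, Fact.out⟩).adicCompletion ℚ) →+* ℚ_[3])) c) = c :=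
      (Padic.adicCompletionEquiv (𝓞 ℚ) ⟨3, Fact.out⟩).apply_symm_apply c
    have h3 : c = ((Padic.adicCompletionEquiv (𝓞 ℚ) ⟨3, Fact.out⟩) (q : ℚ_[3]))⁻¹ := h2.symm.trans h1
    rw [h3, inv_inv]
  have hAt : ∀ h, expStarOmegaAt (dK'.smul c hc) h = c⁻¹ * expStarOmegaAt dK' h :=
    fun h => expStarOmega_smul _ _ dK' hc h
  -- the rescaled line data at every level
  have hcw : ∀ (k' : ℕ) (r : Finset (HeightOneSpectrum (𝓞 ℚ))),
      algebraMap (((Rat.HeightOneSpectrum.primesEquiv (R := 𝓞 ℚ)).symm ⟨3, Fact.out⟩).adicCompletion ℚ)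
        ((w₀' k' r).1.adicCompletion (CyclotomicField (cycLevel 3 k' r) ℚ)) c ≠ 0 := fun k' r =>
    (map_ne_zero_iff _ (algebraMap (((Rat.HeightOneSpectrum.primesEquiv (R := 𝓞 ℚ)).symm ⟨3, Fact.out⟩).adicCompletion ℚ)
      ((w₀' k' r).1.adicCompletion (CyclotomicField (cycLevel 3 k' r) ℚ))).injective).mpr hc
  -- `ZetaBody` is covariant under `Λ ↦ q • Λ` (w2-c2's `zetaBody_rat_smul`), stated for a pointwise-rescaled family
  have hZB : ∀ (ιe : (n : ℕ) → (CyclotomicField n ℚ →+* ℂ)) (κe : ℝ) (c₁ d₁ a₁ : ℤ) (A₁ : ℕ)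
      (Λ₁ Λ₂ : ∀ (k' : ℕ) (r : Finset (HeightOneSpectrum (𝓞 ℚ))),
        H1 (tateRep W 3) (cycSubgroup 3 k' r) →ₗ[ℤ_[3]] ℚ_[3] ⊗[ℚ] CyclotomicField (cycLevel 3 k' r) ℚ)
      (z : ∀ (k' : ℕ) (r : (cyclotomicLevelsRat 3 (badPlaces c₁ d₁ A₁ N)).Ideals),
        H1 (tateRep W 3) ((cyclotomicLevelsRat 3 (badPlaces c₁ d₁ A₁ N)).level k' r.1))
      (x : ∀ (k' : ℕ) (r : (cyclotomicLevelsRat 3 (badPlaces c₁ d₁ A₁ N)).Ideals), CyclotomicField (cycLevel 3 k' r.1) ℚ),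
      (∀ k' r, Λ₁ k' r = (q : ℚ_[3]) • Λ₂ k' r) → ZetaBody W 3 P.f ιe κe Λ₂ c₁ d₁ a₁ A₁ z x →
        ZetaBody W 3 P.f ιe ((q : ℝ) * κe) Λ₁ c₁ d₁ a₁ A₁ z (fun k' r => q • x k' r) := by
    intro ιe κe c₁ d₁ a₁ A₁ Λ₁ Λ₂ z x hΛ hb
    have e : Λ₁ = fun k' r => (q : ℚ_[3]) • Λ₂ k' r := funext fun k' => funext fun r => hΛ k' r
    subst e
    exact zetaBody_rat_smul q hb
  refine ⟨ι', Ψ', hΨ', w₀', g', hg',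
    fun k' r =>
      letI := LocalField.charZero_adicCompletion (w₀' k' r).1
      letI := LocalField.adicCompletionPadicAlgebra (w₀' k' r).1 3 (three_mem_asIdeal_extension _ (w₀' k' r))
      haveI : Fact (¬ IsUnit ((3 : ℕ) : integerC ((w₀' k' r).1.adicCompletion (CyclotomicField (cycLevel 3 k' r) ℚ)))) :=
        ⟨not_isUnit_natCast_integerC (LocalField.valuation_adicCompletion_natCast_lt_one (w₀' k' r).1 3 (three_mem_asIdeal_extension _ (w₀' k' r)))⟩
      haveI := isAdicComplete_integerC_natCast (LocalField.valuation_adicCompletion_natCast_lt_one (w₀' k' r).1 3 (three_mem_asIdeal_extension _ (w₀' k' r)))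
      (dw' k' r).smul _ (hcw k' r),
    hinjw', hexw', fun k' r h => ?_, ?_⟩
  · -- (RES₀) at level (k', r)
    letI := LocalField.charZero_adicCompletion (w₀' k' r).1
    letI := LocalField.adicCompletionPadicAlgebra (w₀' k' r).1 3 (three_mem_asIdeal_extension _ (w₀' k' r))
    haveI : Fact (¬ IsUnit ((3 : ℕ) : integerC ((w₀' k' r).1.adicCompletion (CyclotomicField (cycLevel 3 k' r) ℚ)))) :=
      ⟨not_isUnit_natCast_integerC (LocalField.valuation_adicCompletion_natCast_lt_one (w₀' k' r).1 3 (three_mem_asIdeal_extension _ (w₀' k' r)))⟩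
    haveI := isAdicComplete_integerC_natCast (LocalField.valuation_adicCompletion_natCast_lt_one (w₀' k' r).1 3 (three_mem_asIdeal_extension _ (w₀' k' r)))
    have hres'' := hres' k' r h
    rw [expStarOmegaHom_apply] at hres''
    rw [expStarOmegaHom_apply, expStarOmega_smul, hres'', hAt, map_mul, map_inv₀]
  · -- Kato's body: `katoLambda (c • dw) = q • katoLambda dw` (`katoLambda_smul_line`) and the rational rescaling of the witnesses
    intro c' d' a' A' hA hc' hd'
    obtain ⟨z, x, hbody⟩ := hz' c' d' a' A' hA hc' hd'
    refine ⟨z, fun k' r => q • x k' r, hZB ι' κ' c' d' a' A' _ _ z x (fun k' r => ?_) hbody⟩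
    letI := LocalField.charZero_adicCompletion (w₀' k' r).1
    letI := LocalField.adicCompletionPadicAlgebra (w₀' k' r).1 3 (three_mem_asIdeal_extension _ (w₀' k' r))
    haveI : Fact (¬ IsUnit ((3 : ℕ) : integerC ((w₀' k' r).1.adicCompletion (CyclotomicField (cycLevel 3 k' r) ℚ)))) :=
      ⟨not_isUnit_natCast_integerC (LocalField.valuation_adicCompletion_natCast_lt_one (w₀' k' r).1 3 (three_mem_asIdeal_extension _ (w₀' k' r)))⟩
    haveI := isAdicComplete_integerC_natCast (LocalField.valuation_adicCompletion_natCast_lt_one (w₀' k' r).1 3 (three_mem_asIdeal_extension _ (w₀' k' r)))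
    refine LinearMap.ext fun y => ?_
    exact (katoLambda_smul_line W 3 k' r (w₀' k' r) (Ψ' k' r) (hΨ' k' r) (three_mem_asIdeal_extension _ (w₀' k' r))
      (g' k' r) (hg' k' r) c q he₃q (dw' k' r) (hinjw' k' r) (hexw' k' r) (hcw k' r) y).trans
      (LinearMap.smul_apply _ _ _).symm

end Summit.BirchSwinnertonDyer.BirchSwinnertonDyer.Theorems.KimAtThreeFineKatoDefinedLambdaPosition

end
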